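import Summits.CriticalPhenomena.PercolationContinuityZ3.Theorems.FK.Transplant.FreeBoundaryHypothesesKN
import HarnessLib

/-!
# The conditional Kozma–Nitzan transplant, skeleton of record `_r0` (FT-02) — CONDITIONAL

**CONDITIONAL on `FH` (open at the same `p` for `q > 1`; ⇔ GRC Conj. (5.103) via K1); a typed
reduction, not a proof of FK continuity.** Builds on p205010 (kernel theorem, internal audit signed;
external expert review pending).

Barrier note cited first (FBN-01): `Literature.Barriers.CriticalPhenomena.SamePFreeBoundaryCriteria`
(theorem `samePFreeBoundaryCriteria`, named fact `Bodineau2005_slabThreshold`; landed p243859 — cited by name, not imported). Calibration K1, verbatim: "[C3a ∀ p > p_c(q)] ∧ C3b ⇒ p̂_c(q) = p_c(q) =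
GRC Conj (5.103) = DT Question 5 (open for q ∈ (1,2))". Wording of record (R14(d)): CONDITIONAL on
FH := free-box hittability of the Kozma–Nitzan quarter-face geometry from a wired central seed under the
free random-cluster measure (KN Lemma 9 geometry with free boundary condition). FH is OPEN for `q > 1` at
the same `p`; it FAILS at `p_c(q)` wherever `θ⁰(p_c(q), q) = 0`; at `q = 1` it is KN Lemma 9 and false at
`p_c`. Unconditional content of the completed transplant: `FH(q,p) ⇒ p_c(q) < p`, a necessary condition of
continuity. NEVER "continuity modulo FH".

## The theorem of record

`ufsc0_of_freeBoundaryHypothesis_r0 : FH d q p → KNFreeTargetHittable d q p → KNFreeElongatedHittable d q p →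
KNFreeCorridorRestr d q p → KNFreeOriginLook d q p → KNFreeBadRestr d q p → ∃ r, UFSC0 d q p r ε₀` (for
`3 ≤ d`, `1 ≤ q`, `0 < p < 1`, `0 < ε₀`; `FH` and `UFSC0` are the defs of `FreeBoundaryHypotheses.lean` (FT-01,
p243857), the five PROVE binders are the v2 defs of `FreeBoundaryHypothesesKN.lean` (FT-01b) —
KN's public interfaces (Lemma 10 = `TargetProperty`, Lemma 11, Lemma 12, (32) at the origin, Steps II–IV)
VERBATIM with the law swapped — every one CONSUMED by the proof term). BINDERS OF RECORD: 6 — TWO OPEN: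
`FH` and (lead ruling L7, 2026-08-21) `KNFreeTargetHittable` = TP_FK, Kozma–Nitzan's target Lemma 10 for
finite-volume FK laws (a theorem at `q = 1`; for `q > 1` no derivation from `FH` is known: the first-relay
decoupling `P_{K_ξ}(F_P) = P_G(F_P)` of KN p. 21 is a product identity, and the natural finite-graph
residual "activated set-target gluing" is false already for two relays on four vertices, cell note
GG-REFUTED.md); FOUR PROVE (owners in `transplant/BINDER-OWNERS.md`); DISCHARGED PENDING INSTALL: 0.
Re-cuts `_r1, _r2, …` replace a PROVE binder by its accepted theorem; `_r0` stays. Page-1 framing: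
CONDITIONAL on FH AND on TP_FK.

The proof is the choice of constants of Kozma–Nitzan's Theorem 6 (arXiv:2401.12397, §4 pp. 25–26), the
law-swapped twin of tree `KozmaNitzan.exists_KSch_theta_slab_pos_of_target`: Lemma 12 at `ε₀/2` gives
`δ, m`; `δc = min δ ½`; Lemma 10 at `δc` gives `δ₂` (`δ₂' = min δ₂ 1`); `K ≥ 20` with `(1 - δ₂')^K < ε₀/2`;
`R` from Lemma 10 for the FK-hittable aspect-`2K` elongated geometries (Lemma 11); `s ≥ 1, 2R, m` and the
look thresholds of the aspect-`6` geometries at `δc`; `r = K·s` (T1⁺: every constant a functional of the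
finite-volume laws named in the binders; none of `θ⁰`). No product-measure identity, no `q = 1` fact, no
infinite-volume object, no sprinkling / `p' > p`, no reflection positivity enters (checklist B6/D1).

## References

* G. Kozma, S. Nitzan, arXiv:2401.12397 (2024), §4 Theorem 6 (pp. 25–31) [KozmaNitzan2024].
* G. Grimmett, *The Random-Cluster Model*, Springer 2006, Conj. (5.103) [Grimmett2006].
-/

noncomputable section

open MeasureTheory
open scoped ENNReal Classical

namespace Summit.CriticalPhenomena.PercolationContinuityZ3.Theorems.FK

open Literature.Probability.Percolation Literature.Probability.LatticeModels SimpleGraph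
open Literature.Probability.Percolation.GadgetSystem Literature.Probability.Percolation.KozmaNitzan

variable {d : ℕ}

/-- **The conditional transplant, skeleton of record `_r0`.** CONDITIONAL on `FH` (OPEN for `q > 1` at
the same `p`), on `KNFreeTargetHittable` (TP_FK — OPEN for `q > 1`, KN Lemma 10 at `q = 1`) and on the four
PROVE binders (v2) of `FreeBoundaryHypothesesKN.lean`: for `3 ≤ d`, `1 ≤ q`,
`0 < p < 1` and every `ε₀ > 0` there is a scale `r` at which the uniform free-boundary finite-size
criterion `UFSC0 d q p r ε₀` holds. The hypotheses `_hq`, `_hp` are carried for the record (checklist B4: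
the laws are probability measures and FKG/DM apply only there); the `_r0` composition itself is the
constants bookkeeping of KN pp. 25–26 and does not use them — the discharges installed at `_r1, …` do.
[cite: KozmaNitzan2024, §4 Theorem 6 (pp. 25–26, the constants); Grimmett2006, Conj. (5.103)] -/
theorem ufsc0_of_freeBoundaryHypothesis_r0 (hd : 3 ≤ d) {q : ℝ} {ε₀ : ℝ} (_hq : 1 ≤ q) (hε₀ : 0 < ε₀)
    (p : unitInterval) (_hp : (p : ℝ) ∈ Set.Ioo 0 1)
    (hFH : FH d q p) (h_tgt : KNFreeTargetHittable d q p) (h_elong : KNFreeElongatedHittable d q p)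
    (h_corr : KNFreeCorridorRestr d q p) (h_orig : KNFreeOriginLook d q p) (h_bad : KNFreeBadRestr d q p) :
    ∃ r : ℕ, UFSC0 d q p r ε₀ := by
  -- Lemma 11-FK: FK-hittability of the elongated geometries of every aspect (FH consumed here and in Lemma 12-FK)
  have hel : ∀ (K : ℕ) (hK : 2 ≤ K), ∀ g ∈ elongList d K (by omega), IsHittableFK q p g :=
    h_elong h_tgt hFH
  -- Lemma 12-FK at `ε₀ / 2`
  obtain ⟨δ, hδ0, m, hcorr⟩ := h_corr h_tgt hFH (half_pos hε₀)
  set δc : ℝ := min δ (1 / 2) with hδc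
  have hδc0 : 0 < δc := lt_min hδ0 (by norm_num)
  have hδc1 : δc ≤ 1 := (min_le_right _ _).trans (by norm_num)
  have hδcδ : δc ≤ δ := min_le_left _ _
  -- Lemma 10-FK at `δc`
  obtain ⟨δ₂, hδ₂0, htgt0⟩ := h_tgt hδc0
  set δ₂' : ℝ := min δ₂ 1 with hδ₂'
  have hδ₂'0 : 0 < δ₂' := lt_min hδ₂0 one_pos
  have hδ₂'1 : δ₂' ≤ 1 := min_le_right _ _
  have hδ₂'2 : δ₂' ≤ δ₂ := min_le_left _ _
  -- `K`
  obtain ⟨K₀, hK₀⟩ := exists_pow_lt_of_lt_one (half_pos hε₀) (show 1 - δ₂' < 1 by linarith)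
  set K : ℕ := max K₀ 20 with hK
  have hK20 : 20 ≤ K := le_max_right _ _
  have hKε : (1 - δ₂') ^ K + ε₀ / 2 ≤ ε₀ := by
    have : (1 - δ₂') ^ K ≤ (1 - δ₂') ^ K₀ :=
      pow_le_pow_of_le_one (by linarith) (by linarith) (le_max_left _ _)
    linarith
  -- `R`
  have hK2 : 2 ≤ 2 * K := by omega
  obtain ⟨R, hR⟩ := htgt0 (elongList d (2 * K) (by omega)) (hel (2 * K) hK2)
  -- the look thresholds of the aspect-`6` geometries for (32) at the origin
  set C₀ : Cells d := ⟨hd, 20, 1, le_rfl, le_rfl⟩ with hC₀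
  have hhit6 : ∀ du : MDir, ∃ kℓ : ℕ, ∀ m', kℓ ≤ m' → ∀ ℓ, kℓ ≤ ℓ →
      FKLookAt q p (elongGeom (C₀.axOf du) (σu du) 6 (by norm_num)) δc m' ℓ := by
    intro du
    have hg : elongGeom (C₀.axOf du) (σu du) 6 (by norm_num) ∈ elongList d 6 (by norm_num) :=
      elongGeom_mem_elongList _ _ _ _
    obtain ⟨k, ℓ₀, h⟩ := (hel 6 (by norm_num) _ hg).hit δc hδc0
    exact ⟨max k ℓ₀, fun m' hm' ℓ hℓ => h m' ((le_max_left _ _).trans hm') ℓ ((le_max_right _ _).trans hℓ)⟩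
  choose kℓ hkℓ using hhit6
  set kmax : ℕ := Finset.univ.sup kℓ with hkmax
  have hkmax' : ∀ du, kℓ du ≤ kmax := fun du => Finset.le_sup (f := kℓ) (Finset.mem_univ du)
  -- `s` and the scheme
  set s : ℕ := max (max (max 1 (2 * R)) m) kmax with hs
  have hs1 : 1 ≤ s := le_trans (le_trans (le_max_left _ _) (le_max_left _ _)) (le_max_left _ _)
  have hsR : 2 * R ≤ s := le_trans (le_trans (le_max_right _ _) (le_max_left _ _)) (le_max_left _ _)
  have hsm : m ≤ s := le_trans (le_max_right _ _) (le_max_left _ _)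
  have hsk : kmax ≤ s := le_max_right _ _
  set C : Cells d := ⟨hd, K, s, hK20, hs1⟩ with hCdef
  set S : KSch d := ⟨C, p, δc⟩ with hSdef
  have hsr : s ≤ C.r := by
    show s ≤ K * s
    exact Nat.le_mul_of_pos_left s (by omega)
  refine ⟨C.r, S, rfl, rfl, hδc0, hδc1, fun du => ?_, fun h e du hV hdu => ?_⟩
  · -- (32) at the origin, from one free look of the aspect-`6` geometry at scale `3r`
    refine h_orig S rfl du (hkℓ du (3 * C.r) ?_ (3 * C.r) ?_) <;> linarith [hkmax' du]
  · -- (33) for one direction: Steps II–IV (`h_bad`) fed by Lemma 12-FK and Lemma 10-FK at `S`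
    have hcorrS : FKCorridorRestrAt d q S.p S.δc (ε₀ / 2) S.C.r := by
      intro T hT hTr hyp
      refine hcorr T hT (hsm.trans (hsr.trans hTr)) (lt_of_le_of_lt ?_ hyp)
      show 1 - δ ≤ 1 - δc
      linarith
    have htgtS : FKTargetAt d q S.p δ₂' S.δc (elongList d (2 * S.C.K) (by have := S.C.hK; omega)) R := by
      intro W Sfin D lo hi T o h1 h2 h3 h4 h5 h6 h7 h8 h9 h10
      refine hR W Sfin D lo hi T o h1 h2 h3 h4 h5 h6 h7 h8 h9 (lt_of_le_of_lt ?_ h10)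
      show 1 - δ₂ ≤ 1 - δ₂'
      linarith
    calc (fkLaw (S.Sx h e du) (S.Wfull h e du) q).real (badFK S q h e du)
        ≤ (1 - δ₂') ^ S.C.K + ε₀ / 2 := h_bad S rfl hδ₂'1 hcorrS htgtS hsR h e du hV hdu
      _ ≤ ε₀ := hKε

end Summit.CriticalPhenomena.PercolationContinuityZ3.Theorems.FK

end
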